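import Literature.NumberTheory.LFunctions.TruncatedWeilFormTailOrder
import HarnessLib

/-!
# RH-FREE — «nothing here bears on the truth of RH»: proof of Groskin's finite source calculus (arXiv:2607.02828, Lemma 2.3)

PROOF LAYER for `Literature/NumberTheory/LFunctions/TruncatedWeilFormTailOrder.lean` (cell
`rh-columns/lit`, tranche 1). Discharges the claim `Groskin2026.lemma_2_3`
(A. Groskin, *A finite Guinand–Weil dictionary and archimedean tail order for the truncated Weil
quadratic form*, arXiv:2607.02828v3, Lemma 2.3, p. 5): for the single-frequency source
`ψ_{α,ω}(x) = (α/π) sin(2πωx)`, `⟨v, Q_{α,ω} v⟩ = α K_v(ω)`.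

The proof is the printed one: `K_v(ω) = 2 Σ_{m,n} u_m u_n e^{2πinω} ∫₀^ω e^{2πi(m−n)t} dt`; for
`m ≠ n` the real part of the summand is `u_m u_n (sin 2πωm − sin 2πωn)/(π(m−n))`, for `m = n` it is
`2u_m² ω cos 2πωm`, which are `u_m u_n (Q_{α,ω})_{mn}/α` (the diagonal of the divided-difference matrix
being the derivative `2αω cos 2πωm`); "the imaginary parts cancel in pairs under the even symmetry
`u_{−k} = u_k`" (the involution `(m,n) ↦ (−n,−m)` of `I_N × I_N`). As a by-product the definitions
`evenEmbed`, `dividedDiffMatrix` (diagonal = `deriv`), `trigPoly`, `volterraKernel`, `quadValue` of the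
statement file are pinned against each other by a kernel identity.
-/

noncomputable section

open Filter Set MeasureTheory Complex Finset Matrix
open scoped Real Topology

namespace Literature.NumberTheory.LFunctions

namespace Groskin2026

/-! ### The single-frequency integrals -/

/-- `∫₀^ω e^{2πimt} e^{2πin(ω−t)} dt`, in closed form: `ω e^{2πimω}` if `m = n`,
`(e^{2πimω} − e^{2πinω})/(2πi(m − n))` otherwise. [cite: Groskin2026, proof of Lemma 2.3 (p. 5)] -/
private def pairIntegral (m n : ℤ) (ω : ℝ) : ℂ :=
  if m = n then (ω : ℂ) * cexp (2 * π * I * (m : ℂ) * ω)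
  else (cexp (2 * π * I * (m : ℂ) * ω) - cexp (2 * π * I * (n : ℂ) * ω)) / (2 * π * I * ((m : ℂ) - n))

/-- Real part of `pairIntegral`. [cite: Groskin2026, proof of Lemma 2.3 (p. 5)] -/
private def pairRe (m n : ℤ) (ω : ℝ) : ℝ :=
  if m = n then ω * Real.cos (2 * π * m * ω)
  else (Real.sin (2 * π * m * ω) - Real.sin (2 * π * n * ω)) / (2 * π * ((m : ℝ) - n))

/-- Imaginary part of `pairIntegral`. [cite: Groskin2026, proof of Lemma 2.3 (p. 5)] -/
private def pairIm (m n : ℤ) (ω : ℝ) : ℝ :=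
  if m = n then ω * Real.sin (2 * π * m * ω)
  else -(Real.cos (2 * π * m * ω) - Real.cos (2 * π * n * ω)) / (2 * π * ((m : ℝ) - n))

/-- `e^{2πimx} = cos(2πmx) + i sin(2πmx)`. [folklore] -/
private theorem cexp_freq (m : ℤ) (x : ℝ) :
    cexp (2 * π * I * (m : ℂ) * x) = (Real.cos (2 * π * m * x) : ℂ) + (Real.sin (2 * π * m * x) : ℂ) * I := by
  rw [show (2 * π * I * (m : ℂ) * x : ℂ) = ((2 * π * m * x : ℝ) : ℂ) * I by push_cast; ring,
    Complex.exp_mul_I, Complex.ofReal_cos, Complex.ofReal_sin]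

/-- The closed form of the elementary integral. [cite: Groskin2026, proof of Lemma 2.3 (p. 5)] -/
private theorem integral_cexp_pair (m n : ℤ) (ω : ℝ) :
    ∫ t in (0 : ℝ)..ω, cexp (2 * π * I * (m : ℂ) * t) * cexp (2 * π * I * (n : ℂ) * ((ω : ℝ) - t : ℝ)) =
      pairIntegral m n ω := by
  have hrw : ∀ t : ℝ, cexp (2 * π * I * (m : ℂ) * t) * cexp (2 * π * I * (n : ℂ) * ((ω : ℝ) - t : ℝ)) =
      cexp (2 * π * I * (n : ℂ) * ω) * cexp ((2 * π * I * ((m : ℂ) - n)) * t) := by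
    intro t
    rw [← Complex.exp_add, ← Complex.exp_add]
    congr 1
    push_cast
    ring
  simp_rw [hrw]
  rw [intervalIntegral.integral_const_mul]
  unfold pairIntegral
  split_ifs with h
  · subst h
    simp only [sub_self, mul_zero, zero_mul, Complex.exp_zero, intervalIntegral.integral_const,
      sub_zero, real_smul, mul_one]
    ring
  · have hc : (2 * π * I * ((m : ℂ) - n)) ≠ 0 := by
      have hmn : ((m : ℂ) - n) ≠ 0 := by
        rw [sub_ne_zero]
        exact_mod_cast h
      have hpi : (π : ℂ) ≠ 0 := by exact_mod_cast Real.pi_ne_zero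
      simp [hmn, hpi, Complex.I_ne_zero]
    rw [integral_exp_mul_complex hc]
    simp only [Complex.ofReal_zero, mul_zero, Complex.exp_zero]
    rw [mul_div_assoc', mul_sub, mul_one, ← Complex.exp_add]
    congr 2
    ring

/-- `pairIntegral = pairRe + i · pairIm`. [cite: Groskin2026, proof of Lemma 2.3 (p. 5)] -/
private theorem pairIntegral_eq (m n : ℤ) (ω : ℝ) :
    pairIntegral m n ω = (pairRe m n ω : ℂ) + (pairIm m n ω : ℂ) * I := by
  unfold pairIntegral pairRe pairIm
  split_ifs with h
  · rw [cexp_freq]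
    push_cast
    ring
  · have hmn : ((m : ℝ) - n) ≠ 0 := by
      rw [sub_ne_zero]
      exact_mod_cast h
    have hmnC : ((m : ℂ) - n) ≠ 0 := by
      rw [sub_ne_zero]
      exact_mod_cast h
    have hpi : (π : ℂ) ≠ 0 := by exact_mod_cast Real.pi_ne_zero
    rw [cexp_freq, cexp_freq]
    push_cast
    field_simp
    ring_nf
    rw [Complex.I_sq]
    ring

/-- Antisymmetry of the imaginary part under `(m,n) ↦ (−n,−m)`. [cite: Groskin2026, proof of Lemma 2.3 (p. 5)] -/
private theorem pairIm_neg_swap (m n : ℤ) (ω : ℝ) : pairIm (-n) (-m) ω = -pairIm m n ω := by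
  unfold pairIm
  by_cases h : m = n
  · subst h
    simp only [if_true]
    push_cast
    rw [show (2 * π * -(m : ℝ) * ω) = -(2 * π * m * ω) by ring, Real.sin_neg]
    ring
  · have h' : ¬(-n = -m) := fun e ↦ h (by omega)
    rw [if_neg h', if_neg h]
    have hmn : ((m : ℝ) - n) ≠ 0 := by
      rw [sub_ne_zero]; exact_mod_cast h
    have hmn2 : (-(n : ℝ) - -(m : ℝ)) = ((m : ℝ) - n) := by ring
    push_cast
    rw [show (2 * π * -(n : ℝ) * ω) = -(2 * π * n * ω) by ring,
      show (2 * π * -(m : ℝ) * ω) = -(2 * π * m * ω) by ring, Real.cos_neg, Real.cos_neg, hmn2]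
    rw [neg_div, neg_div, neg_neg, ← neg_div, neg_sub]

/-! ### The negation involution of `I_N` -/

/-- `m ↦ −m` on `I_N`. [cite: Groskin2026, §2.1 (p. 3)] -/
private def negIdx (N : ℕ) : idx N ≃ idx N where
  toFun m := ⟨-(m : ℤ), by
    have := Finset.mem_Icc.1 m.2; simp only [idx, Finset.mem_Icc]; omega⟩
  invFun m := ⟨-(m : ℤ), by
    have := Finset.mem_Icc.1 m.2; simp only [idx, Finset.mem_Icc]; omega⟩
  left_inv m := by ext; simp
  right_inv m := by ext; simp

/-- `negIdx` is negation on the underlying integers. [folklore] -/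
@[simp] private theorem coe_negIdx {N : ℕ} (m : idx N) : ((negIdx N m : idx N) : ℤ) = -(m : ℤ) := rfl

/-- The even symmetry `u_{−k} = u_k` of the embedding. [cite: Groskin2026, §2.1 (p. 3)] -/
private theorem evenEmbed_negIdx (N : ℕ) (v : Fin (N + 1) → ℝ) (m : idx N) :
    evenEmbed N v (negIdx N m) = evenEmbed N v m := by
  unfold evenEmbed
  simp only [coe_negIdx, neg_eq_zero, Int.natAbs_neg]

/-- "The imaginary parts cancel in pairs under the even symmetry." [cite: Groskin2026, proof of Lemma 2.3 (p. 5)] -/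
private theorem sum_pairIm_eq_zero (N : ℕ) (v : Fin (N + 1) → ℝ) (ω : ℝ) :
    ∑ m : idx N, ∑ n : idx N, evenEmbed N v m * evenEmbed N v n * pairIm m n ω = 0 := by
  set u := evenEmbed N v with hu
  have e1 : ∑ m : idx N, ∑ n : idx N, u m * u n * pairIm m n ω =
      ∑ m : idx N, ∑ n : idx N, u (negIdx N m) * u n * pairIm (negIdx N m) n ω :=
    ((negIdx N).sum_comp (fun m ↦ ∑ n : idx N, u m * u n * pairIm m n ω)).symm
  have e2 : ∑ m : idx N, ∑ n : idx N, u (negIdx N m) * u n * pairIm (negIdx N m) n ω =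
      ∑ m : idx N, ∑ n : idx N, u (negIdx N m) * u (negIdx N n) * pairIm (negIdx N m) (negIdx N n) ω :=
    Finset.sum_congr rfl fun m _ ↦
      ((negIdx N).sum_comp (fun n ↦ u (negIdx N m) * u n * pairIm (negIdx N m) n ω)).symm
  have e3 : ∑ m : idx N, ∑ n : idx N, u (negIdx N m) * u (negIdx N n) * pairIm (negIdx N m) (negIdx N n) ω =
      ∑ n : idx N, ∑ m : idx N, u (negIdx N m) * u (negIdx N n) * pairIm (negIdx N m) (negIdx N n) ω :=
    Finset.sum_comm
  have e4 : ∑ n : idx N, ∑ m : idx N, u (negIdx N m) * u (negIdx N n) * pairIm (negIdx N m) (negIdx N n) ω =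
      -∑ n : idx N, ∑ m : idx N, u n * u m * pairIm n m ω := by
    rw [← Finset.sum_neg_distrib]
    refine Finset.sum_congr rfl fun n _ ↦ ?_
    rw [← Finset.sum_neg_distrib]
    refine Finset.sum_congr rfl fun m _ ↦ ?_
    rw [hu, evenEmbed_negIdx, evenEmbed_negIdx, coe_negIdx, coe_negIdx, pairIm_neg_swap]
    ring
  linarith [e1.trans (e2.trans (e3.trans e4))]

/-! ### The two sides -/

/-- The diagonal of `Q_{α,ω}`: `ψ′_{α,ω}(x) = 2αω cos(2πωx)`. [cite: Groskin2026, proof of Lemma 2.3 (p. 5)] -/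
private theorem deriv_singleFreq (α ω x : ℝ) :
    deriv (fun x ↦ α / π * Real.sin (2 * π * ω * x)) x = 2 * α * ω * Real.cos (2 * π * ω * x) := by
  have h1 : HasDerivAt (fun y : ℝ ↦ 2 * π * ω * y) (2 * π * ω) x := by
    simpa using (hasDerivAt_id x).const_mul (2 * π * ω)
  have h2 : HasDerivAt (fun y : ℝ ↦ Real.sin (2 * π * ω * y))
      (Real.cos (2 * π * ω * x) * (2 * π * ω)) x := (Real.hasDerivAt_sin _).comp x h1
  have h3 := h2.const_mul (α / π)
  rw [h3.deriv]
  field_simp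

/-- The entries of `Q_{α,ω}` are `2α · pairRe`. [cite: Groskin2026, proof of Lemma 2.3 (p. 5)] -/
private theorem singleFreq_entry (N : ℕ) (α ω : ℝ) (m n : idx N) :
    dividedDiffMatrix (fun x ↦ α / π * Real.sin (2 * π * ω * x)) N m n = 2 * α * pairRe m n ω := by
  unfold dividedDiffMatrix pairRe
  simp only [Matrix.of_apply]
  by_cases h : (m : ℤ) = n
  · rw [if_pos h, if_pos h, deriv_singleFreq]
    ring_nf
  · rw [if_neg h, if_neg h]
    have hmn : ((m : ℤ) : ℝ) - ((n : ℤ) : ℝ) ≠ 0 := by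
      rw [sub_ne_zero]; exact_mod_cast h
    have hpi : (π : ℝ) ≠ 0 := Real.pi_ne_zero
    field_simp

/-- The left-hand side as a double sum. [cite: Groskin2026, proof of Lemma 2.3 (p. 5)] -/
private theorem quadValue_eq_sum (N : ℕ) (v : Fin (N + 1) → ℝ) (Q : Matrix (idx N) (idx N) ℝ) :
    quadValue N v Q = ∑ m : idx N, ∑ n : idx N, evenEmbed N v m * evenEmbed N v n * Q m n := by
  unfold quadValue dotProduct Matrix.mulVec dotProduct
  refine Finset.sum_congr rfl fun m _ ↦ ?_
  rw [Finset.mul_sum]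
  refine Finset.sum_congr rfl fun n _ ↦ ?_
  ring

/-- The Volterra kernel as a double sum of `pairIntegral`s. [cite: Groskin2026, proof of Lemma 2.3 (p. 5)] -/
private theorem volterraKernel_eq_sum (N : ℕ) (v : Fin (N + 1) → ℝ) (ω : ℝ) :
    volterraKernel N v ω =
      2 * ∑ m : idx N, ∑ n : idx N, (evenEmbed N v m : ℂ) * (evenEmbed N v n : ℂ) * pairIntegral m n ω := by
  unfold volterraKernel
  congr 1
  have hprod : ∀ t : ℝ, trigPoly N v t * trigPoly N v (ω - t) =
      ∑ m : idx N, ∑ n : idx N, (evenEmbed N v m : ℂ) * (evenEmbed N v n : ℂ) *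
        (cexp (2 * π * I * ((m : ℤ) : ℂ) * t) * cexp (2 * π * I * ((n : ℤ) : ℂ) * ((ω : ℝ) - t : ℝ))) := by
    intro t
    unfold trigPoly
    rw [Finset.sum_mul_sum]
    refine Finset.sum_congr rfl fun m _ ↦ Finset.sum_congr rfl fun n _ ↦ ?_
    push_cast
    ring
  simp_rw [hprod]
  have hint : ∀ (m n : idx N), IntervalIntegrable (fun t : ℝ ↦ (evenEmbed N v m : ℂ) * (evenEmbed N v n : ℂ) *
      (cexp (2 * π * I * ((m : ℤ) : ℂ) * t) * cexp (2 * π * I * ((n : ℤ) : ℂ) * ((ω : ℝ) - t : ℝ))))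
      volume 0 ω := by
    intro m n
    apply Continuous.intervalIntegrable
    fun_prop
  rw [intervalIntegral.integral_finsetSum fun m _ ↦ ?_]
  · refine Finset.sum_congr rfl fun m _ ↦ ?_
    rw [intervalIntegral.integral_finsetSum fun n _ ↦ hint m n]
    refine Finset.sum_congr rfl fun n _ ↦ ?_
    rw [intervalIntegral.integral_const_mul, integral_cexp_pair]
  · exact (continuous_finsetSum _ fun n _ ↦ (hint m n |>.1 |> fun _ ↦ by fun_prop)).intervalIntegrable _ _

/-- **[Gr26] Lemma 2.3, PROVED** (discharge of the claim `lemma_2_3`): `⟨v, Q_{α,ω} v⟩ = α K_v(ω)`.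
[cite: Groskin2026, Lemma 2.3 (p. 5)] -/
theorem lemma_2_3_holds : lemma_2_3 := by
  intro N v α ω
  have him := sum_pairIm_eq_zero N v ω
  have himC : ∑ m : idx N, ∑ n : idx N,
      (evenEmbed N v m : ℂ) * (evenEmbed N v n : ℂ) * (pairIm m n ω : ℂ) = 0 := by
    have := congrArg (fun r : ℝ ↦ (r : ℂ)) him
    push_cast at this
    exact this
  have hL : ((quadValue N v (dividedDiffMatrix (fun x ↦ α / π * Real.sin (2 * π * ω * x)) N) : ℝ) : ℂ) =
      ∑ m : idx N, ∑ n : idx N,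
        (evenEmbed N v m : ℂ) * (evenEmbed N v n : ℂ) * (2 * α * (pairRe m n ω : ℂ)) := by
    rw [quadValue_eq_sum]
    push_cast
    refine Finset.sum_congr rfl fun m _ ↦ Finset.sum_congr rfl fun n _ ↦ ?_
    rw [singleFreq_entry]
    push_cast
    ring
  have hR : (α : ℂ) * volterraKernel N v ω =
      (∑ m : idx N, ∑ n : idx N,
        (evenEmbed N v m : ℂ) * (evenEmbed N v n : ℂ) * (2 * α * (pairRe m n ω : ℂ))) +
      2 * α * I * ∑ m : idx N, ∑ n : idx N,
        (evenEmbed N v m : ℂ) * (evenEmbed N v n : ℂ) * (pairIm m n ω : ℂ) := by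
    rw [volterraKernel_eq_sum]
    simp only [Finset.mul_sum, ← Finset.sum_add_distrib]
    refine Finset.sum_congr rfl fun m _ ↦ Finset.sum_congr rfl fun n _ ↦ ?_
    rw [pairIntegral_eq]
    ring
  rw [hL, hR, himC, mul_zero, add_zero]

end Groskin2026

end Literature.NumberTheory.LFunctions

end
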